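import Summits.BirchSwinnertonDyer.BirchSwinnertonDyer.Theses.TameQuarticSolvent
import Summits.BirchSwinnertonDyer.BirchSwinnertonDyer.Theses.TameQuarticManinParity
import Literature.NumberTheory.EllipticCurves.Rank1Residual.Typed.Basic
import HarnessLib

/-!
# Route `TameQuarticSolvent`, crux `SolventPairLowerBound` (stmt-BirchSwinnertonDyer-21391) —
# the crux BY NAME from the rank-one lower half at `3` and a `3`-ADIC UNIT TWIST SUPPLY (lead g4's §3.3 shape)

HONEST FRAMING. Theorems only; helper (`--supports stmt-BirchSwinnertonDyer-21391`, width seat `bsd-wall-tqs-p1-w3`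
gen 2), CONDITIONAL on every displayed hypothesis; credits nothing toward closing the item; BSD is not proved by any
of this. No definition, no named fact, no restatement of the crux (the route decl is concluded BY NAME).

WHAT. Lead tqs-p1 g4 (`Cruxes/SolventPairLowerBound/LEAD-g4-21391.md` §1, p588900) records that the pair inequality
of the crux is the SUM of the two `ℚ`-side lower halves at `3` — `Typed.MissingLowerBoundAt W 3` for `E` (rank one,
item `TameQuarticManinParity.TprimeRankOneLowerAtThree`, stmt-BirchSwinnertonDyer-23739) and for the twist `E_d`
(rank zero, KT's `TameLowerHalfRankZero`). His §3.3 («for ideation, not filed») observes that the rank-zero conjunct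
becomes TRIVIAL if the admissible twist can be CHOSEN with `ord₃ #Ш_an(E_d) ≤ 0` — `0 ≤ ord₃ #Ш(E_d)` always. This
file is that observation in kernel form:
* `solventPairLowerBound_of_missingLowerBoundAt_of_unitTwistSupply` — crux ⟸ (lower half at `3` on the (t′)
  rank-one rows) ∧ UNIT-TWIST SUPPLY: every `W` on the leaf has an admissible twist datum (`d > 0`, `ord₃ d = 1`,
  globally minimal non-CM (t′) model `Wd` of `W^{(d)}`, `r_an(Wd) = 0`) whose analytic `Ш` is a rational `q′` with
  `padicValRat 3 q′ ≤ 0`;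
* `solventPairLowerBound_of_tprimeRankOneLowerAtThree_of_unitTwistSupply` — the same with 23739 BY NAME.
The supply hypothesis is a Friedberg–Hoffstein-type non-vanishing statement SHARPENED to `3`-adic units in the local
class `{d > 0, 3 ∥ d}` (Kriz–Li, Forum Math. Sigma 7 (2019), for curves with a rational `3`-isogeny — 2 705 of the
3 533 leaf classes — but without these local conditions; not in the tree, NOT asserted here). Instrument (memo
`PARITY-K2A-REST-w3.md` §5): the 10 admissible pairs `(E, d)` with `N(E^{(d)}) < 5·10⁵` in the ecdata mirror have
`r(E^{(d)}) = 0` and `#Ш_an(E^{(d)}) = 1` in 9 cases (the tenth has rank 2); on all (t′) rank-zero classes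
2 866 / 4 130 have no member with `3 ∣ #Ш_an`.

References: R. L. Miller, LMS J. Comput. Math. 14 (2011) Def. 1.1; D. Kriz, C. Li, Forum Math. Sigma 7 (2019) e15;
S. Friedberg, J. Hoffstein, Ann. of Math. 142 (1995) Thm. B (1).
-/

-- D-0017: single-problem summit, so `Summit.BirchSwinnertonDyer.BirchSwinnertonDyer.…` repeats a namespace BY DESIGN.
set_option linter.dupNamespace false

noncomputable section

open WeierstrassCurve Literature.NumberTheory.EllipticCurves Literature.NumberTheory.EllipticCurves.Rank1Residual

namespace Summit.BirchSwinnertonDyer.BirchSwinnertonDyer.Theorems.SolventPairLowerBound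

/-- **The crux from the rank-one lower half at `3` and a `3`-adic unit twist supply.** GIVEN the lower half
`ord₃ #Ш_an ≤ ord₃ #Ш` (`Typed.MissingLowerBoundAt · 3`) on the non-CM (t′) rank-ONE rows (`hL1`) and, for every
such `W`, an admissible rank-zero twist datum `(d, Wd)` whose analytic `Ш` is a rational of NON-POSITIVE `3`-adic
valuation (`hU`), the route decl `SolventPairLowerBound` holds: `ord₃ q ≤ ord₃ #Ш(W)` and
`ord₃ q′ ≤ 0 ≤ ord₃ #Ш(Wd)` add up. CONDITIONAL; credits nothing. [cite: Miller2011LMS, Def. 1.1] -/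
theorem solventPairLowerBound_of_missingLowerBoundAt_of_unitTwistSupply
    (hL1 : ∀ (W : WeierstrassCurve ℚ) [W.IsElliptic] [W.IsGloballyMinimal],
      ¬ W.HasCM → Addv W 3 → Summit.BirchSwinnertonDyer.Rank1Residual.Additive.SubTprime W 3 →
        W.analyticRank = 1 → Typed.MissingLowerBoundAt W 3)
    (hU : ∀ (W : WeierstrassCurve ℚ) [W.IsElliptic] [W.IsGloballyMinimal],
      ¬ W.HasCM → Addv W 3 → Summit.BirchSwinnertonDyer.Rank1Residual.Additive.SubTprime W 3 →
        W.analyticRank = 1 →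
      ∃ (d : ℤ) (Wd : WeierstrassCurve ℚ) (_ : Wd.IsElliptic) (_ : Wd.IsGloballyMinimal),
        0 < d ∧ padicValInt 3 d = 1 ∧
        (∃ C : WeierstrassCurve.VariableChange ℚ, C • W.quadraticTwist (d : ℚ) = Wd) ∧
        ¬ Wd.HasCM ∧ Addv Wd 3 ∧ Summit.BirchSwinnertonDyer.Rank1Residual.Additive.SubTprime Wd 3 ∧
        Wd.analyticRank = 0 ∧ ∃ q' : ℚ, shaAn Wd = (q' : ℂ) ∧ padicValRat 3 q' ≤ 0) :
    Summit.BirchSwinnertonDyer.BirchSwinnertonDyer.Theses.TameQuarticSolvent.SolventPairLowerBound := by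
  intro W _ _ hCM hadd hsub hr
  obtain ⟨d, Wd, i1, i2, hd, hv, htw, hCMd, haddd, hsubd, hr0, q', hq', hle'⟩ := hU W hCM hadd hsub hr
  obtain ⟨q, hq, hle⟩ := hL1 W hCM hadd hsub hr
  refine ⟨d, Wd, i1, i2, hd, hv, htw, hCMd, haddd, hsubd, hr0, q, q', hq, hq', ?_⟩
  have h0 : (0 : ℤ) ≤ (padicValNat 3 Wd.shaOrder : ℤ) := Int.natCast_nonneg _
  linarith

/-- **The same BY NAME from item 23739.** GIVEN `TameQuarticManinParity.TprimeRankOneLowerAtThree`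
(stmt-BirchSwinnertonDyer-23739: the lower half at `3` on the (t′) rank-one leaf) and the `3`-adic unit twist supply,
the deciding crux `SolventPairLowerBound` of route `TameQuarticSolvent` (stmt-BirchSwinnertonDyer-21391) holds — the
rank-zero lower half (KT 19981 / split child 23963's twisted detour) is then not needed at all. CONDITIONAL; credits
nothing; neither hypothesis is proved here. [cite: Miller2011LMS, Def. 1.1] -/
theorem solventPairLowerBound_of_tprimeRankOneLowerAtThree_of_unitTwistSupply
    (h1 : Summit.BirchSwinnertonDyer.BirchSwinnertonDyer.Theses.TameQuarticManinParity.TprimeRankOneLowerAtThree)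
    (hU : ∀ (W : WeierstrassCurve ℚ) [W.IsElliptic] [W.IsGloballyMinimal],
      ¬ W.HasCM → Addv W 3 → Summit.BirchSwinnertonDyer.Rank1Residual.Additive.SubTprime W 3 →
        W.analyticRank = 1 →
      ∃ (d : ℤ) (Wd : WeierstrassCurve ℚ) (_ : Wd.IsElliptic) (_ : Wd.IsGloballyMinimal),
        0 < d ∧ padicValInt 3 d = 1 ∧
        (∃ C : WeierstrassCurve.VariableChange ℚ, C • W.quadraticTwist (d : ℚ) = Wd) ∧
        ¬ Wd.HasCM ∧ Addv Wd 3 ∧ Summit.BirchSwinnertonDyer.Rank1Residual.Additive.SubTprime Wd 3 ∧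
        Wd.analyticRank = 0 ∧ ∃ q' : ℚ, shaAn Wd = (q' : ℂ) ∧ padicValRat 3 q' ≤ 0) :
    Summit.BirchSwinnertonDyer.BirchSwinnertonDyer.Theses.TameQuarticSolvent.SolventPairLowerBound :=
  solventPairLowerBound_of_missingLowerBoundAt_of_unitTwistSupply h1 hU

end Summit.BirchSwinnertonDyer.BirchSwinnertonDyer.Theorems.SolventPairLowerBound

end
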